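import Mathlib
import Summits.Langlands.Langlands.Theses.NonParallelVoid
import Literature.NumberTheory.GaloisRepresentations.PstCrystallineExtensionData
import Literature.NumberTheory.GaloisRepresentations.AbsGaloisGroup
import HarnessLib

/-!
# BC3 birth skeleton — crux `TensorSquareParallel` (item stmt-Langlands-17009) of route `NonParallelVoid`

Skeleton registrar `planner-skel-stmt-Langlands-17009-0`, 2026-08-17 (route re-audit bin REPAIRABLE).
Published as `Cruxes/TensorSquareParallel/Lines/birth.lean`.

The crux (rank 4, "CALEGARI'S TENSOR, NON-ORDINARY"): for `F` imaginary quadratic, `p ≥ 11` split,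
`ρ : Γ_F → GL₂(ℚ̄_p)` irreducible, a.e. unramified, crystalline at both `v ∣ p` with labelled Hodge–Tate weights
`{a_v, b_v}`, `a_v < b_v`, `ρ̄|Γ_{F(ζ_p)}` absolutely irreducible, gap difference ODD (`¬` "all gap sums even")
and `ρ̄` NOT of base-change type ⟹ the gaps are parallel.  Since parallel gaps have even gap sums, the
conclusion is reached through a CONTRADICTION: the non-parallel sector is void there.  The line is Calegari
2010 §2 upgraded from ordinary to potentially diagonalisable (route header, LEVER 2): the tensor induction
`ψ = ⊗-Ind_{Γ_F}^{Γ_ℚ} ρ` (restriction `ρ ⊗ ρ^c`) is regular exactly because the gaps differ, orthogonal with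
totally even multiplier, potentially diagonalisable and — off the projectively dihedral corner — residually
irreducible on `Γ_{ℚ(ζ_p)}`; [BLGGT] Thm. C makes it automorphic over a totally real field, where
Caraiani–Le Hung force `tr ψ(c) = 0`, whereas `tr ψ(c) = ±2`.

Stubs (5, each a genuine lemma of the line; statements over existing declarations only):
* `stub_localPD` — two-dimensional crystalline HT-regular representations of `Γ_{ℚ_p}` (`p ≥ 11`, pinned datum) are
  potentially diagonalisable for every instance of crystalline extension data ([BLGGT] §1.4; the local bet; size M);
* `stub_tensorInduction` — the tensor induction exists with properties (T0) character on `Γ_F`, (T1) a.e.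
  unramified, (T2) `GO₄` with totally even multiplier, (T3) crystalline + four distinct labelled HT numbers + PD
  at `p`, (T5) `tr ψ(c) ≠ 0` (Calegari 2010 Lemma 2.1; construction, size L);
* `stub_residualIrreducibility` — not base-change type + not projectively dihedral over `F(ζ_p)` ⟹ `ψ̄|Γ_{ℚ(ζ_p)}`
  absolutely irreducible (Clifford theory; the crux's recorded risk, isolated; size M);
* `stub_traceComplexConjugation` — [BLGGT] Thm. C + Caraiani–Le Hung Thm. 1.1 for `n = 4` over `ℚ`:
  such `ψ` have `tr ψ(c) = 0` (published theorems; citation-grade);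
* `stub_dihedralCorner` — the crux on the projectively dihedral locus (CM/dihedral methods; open remainder).

`TensorSquareParallel_of (h₁ … h₅) : TensorSquareParallel` is KERNEL-CHECKED below (no sorry outside `stub_*`;
each `_Goal.stub_k : Prop := type_of% @stub_k` is the stub's statement BY NAME, the registrar's convention):
case split on the dihedral predicate; on the corner, stub 5; off it, the failure of the parity clause yields two
labels with different gaps (an elementary parity step proved here), stub 2 (fed by stub 1 at `p`) produces `ψ`, stub 3 its residual
irreducibility, stub 4 `tr ψ(c) = 0` at a complex conjugation `c` of `Γ_ℚ`
(`exists_isComplexConjugation (Rat.castHom ℝ)`), contradicting (T5).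

Honesty notes. (i) No stub is the crux or the summit reworded: stubs 1–3 conclude properties of local
constituents / of a rank-four representation of `Γ_ℚ`, stub 4 is a theorem about rank-four representations of
`Γ_ℚ`, stub 5 carries the extra dihedral hypothesis; BC3 probes `stub → TensorSquareParallel`, `stub → Langlands`
by `exact? | simpa | aesop` fail (seat folder `bc/`).  (ii) Disproof.lean / Negative lemmas for this crux: none
exist (`ledger crux ls stmt-Langlands-17009`: no workfiles before this one); `ledger negatives --problem Langlands`
(3 entries) are unrelated.  (iii) The crux as typed carries no `(h : Fact)` antecedents, so stub 4 (two published
theorems) is stated as a theorem to be proved/vendored, exactly as the sign fact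
`CaraianiLeHung2016_thm_1_1` already vendored for this item.

References: F. Calegari, Invent. Math. 185 (2011) = arXiv:0907.3427, §2 [Calegari2010]; T. Barnet-Lamb,
T. Gee, D. Geraghty, R. Taylor, Ann. of Math. 179 (2014) = arXiv:1010.2561, §1.4, §2.1, Thm. C
[BarnetlambEtAl2014]; A. Caraiani, B. Le Hung, Compositio 152 (2016), Thm. 1.1 [CaraianiLehung2016];
F. Calegari, B. Mazur, J. Inst. Math. Jussieu 8 (2009), Conj. 1.3, §2.4 [CalegariMazur2008];
M. Kisin, JAMS 21 (2008) [Kisin2007].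
-/

noncomputable section

set_option linter.dupNamespace false

open scoped NumberField
open IsDedekindDomain Field
open Literature.NumberTheory.GaloisRepresentations Literature.NumberTheory.PAdicHodge

namespace Summit.Langlands.Langlands.Cruxes.TensorSquareParallel.Birth

/-- **stub 1 — the local `p`-adic Hodge input: two-dimensional crystalline Hodge–Tate-regular
representations of `Γ_{ℚ_p}` are potentially diagonalisable.**  Intrinsic local statement at the place `v` of `ℚ`
above `p ≥ 11` (`ℚ_p = v.adicCompletion ℚ` with the summit's pinned Fontaine datum `fontainePstAdicCompletion v p hv`):
every `r : Γ_{ℚ_p} → GL₂(ℚ̄_p)` which is crystalline for the datum and has distinct `τ`-labelled Hodge–Tate weights is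
potentially diagonalisable in the sense of [BLGGT] §1.4 (`IsPotentiallyDiagonalizable`), relative to EVERY instance
`𝔈` of compatible crystalline extension data over the datum (the tree's convention, as in route
`WachComponentCensus`).  This is the `l = p` hypothesis "potentially diagonalizable at each prime above `l`" of
[BLGGT] Thm. C for the tensor induction, whose restriction to `Γ_{ℚ_p}` is `ρ|Γ_{F_v} ⊗ ρ|Γ_{F_w}` transported along
`F_v = F_w = ℚ_p` (PD is stable under `⊗`, [BLGGT] §1.4); stub 2 consumes this statement verbatim.  Why plausibly
true: ordinary `r` by [BLGGT] Lemma 1.4.3 (1) (PROVED in the tree for every `𝔈`: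
`PstCrystallineExtensionData.isPotentiallyDiagonalizable_of_hasInvariantCompleteFlag`); gap `≤ p − 2` by Lemma
1.4.3 (2) (Fontaine–Laffaille, Gao–Liu); irreducible `r` of larger gap: the Berger–Li–Zhu / Kisin families of
crystalline `Γ_{ℚ_p}`-representations connect `V_{k,a_p}` to induced (hence PD over `ℚ_{p²}`) or ordinary points —
expected, not vendored; [BLGGT] p. 4 record the general question ("Could every crystalline representation be
potentially diagonalizable?") as open.  It is the route's standing local bet (the sibling crux
`TwistedInductionParallel` names the same input: "believed known, else route WachComponentCensus").  Size M.
[cite: BarnetlambEtAl2014, §1.4 Lemma 1.4.3 and p. 4] [cite: Kisin2007, Cor. 2.7.7 and Thm. 3.3.8] -/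
theorem stub_localPD :
    ∀ (p : ℕ) [Fact p.Prime], 11 ≤ p → (∀ (v : HeightOneSpectrum (𝓞 ℚ)) (hv : ((p : ℕ) : 𝓞 ℚ) ∈ v.asIdeal) (r : FramedGaloisRep (v.adicCompletion ℚ) (PadicAlgCl p) 2), (fontainePstAdicCompletion v p hv).IsCrystallineFramed r → (letI := (fontainePstAdicCompletion v p hv).algebra; (∀ τ : v.adicCompletion ℚ →ₐ[ℚ_[p]] PadicAlgCl p, ((fontainePstAdicCompletion v p hv).𝔅.labelledHodgeTateWeights r.toGaloisRep τ.toRingHom).Nodup) → ∀ 𝔈 : PstCrystallineExtensionData (fontainePstAdicCompletion v p hv), IsPotentiallyDiagonalizable 𝔈.𝔅 r)) := by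
  sorry

/-- **stub 2 — Calegari's tensor induction `ψ = ⊗-Ind_{Γ_F}^{Γ_ℚ} ρ` exists with its standard
properties** (Calegari 2010 §2 "The tensor representation", Lemma 2.1–2.3; pure construction and
bookkeeping, no residual hypothesis).  Given the crux data in the good regime, two labels with DIFFERENT gaps
`b − a ≠ b' − a'` and stub 1's local input (PD of two-dimensional crystalline regular representations of `Γ_{ℚ_p}`,
consumed verbatim), there is a continuous
`ψ : Γ_ℚ → GL₄(ℚ̄_p)` with: (T0) `ψ|Γ_F` has the character of `ρ ⊗ ρ^τ` (`tr ψ(σ) = tr ρ(σ)·tr ρ(τστ⁻¹)`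
for every `τ ∈ Γ_ℚ ∖ Γ_F`); (T1) unramified almost everywhere; (T2) `ψ` lands in `GO₄` with TOTALLY EVEN
multiplier — the symmetric pairing `ε ⊗ ε` (`ε` = the alternating form `∧²` on `ℚ̄_p²`) has multiplier `μ`
with `μ|Γ_F = det ρ · det ρ^c` and `μ(c) = det ρ(c²) = 1`; (T3) at `p`: crystalline (`ψ|Γ_{ℚ_p} ≅ ρ|Γ_{F_v} ⊗
ρ|Γ_{F_w}`), labelled Hodge–Tate weights `{a+a', a+b', b+a', b+b'}` — FOUR DISTINCT numbers exactly because
the gaps differ — and potentially diagonalisable (`⊗` of PD is PD, [BLGGT] §1.4); (T5) `tr ψ(c) = ±2 ≠ 0` for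
every complex conjugation `c` (`c ∉ Γ_F` acts on `V ⊗ V^c` by the swap, Calegari 2010 Lemma 2.1).  Why
plausibly true: it is the construction; the tree has ordinary induction `FramedGaloisRep.induce` but not yet
tensor induction, so the stub includes building it for the index-two subgroup `Γ_F ⊲ Γ_ℚ`.  Size L (formal).
[cite: Calegari2010, §2 (Lemma 2.1)] [cite: BarnetlambEtAl2014, §1.4 and §2.1] -/
theorem stub_tensorInduction :
    ∀ (F : Type) [Field F] [NumberField F] [Algebra.IsQuadraticExtension ℚ F], NumberField.IsTotallyComplex F → ∀ (p : ℕ) [Fact p.Prime] (ρ : FramedGaloisRep F (PadicAlgCl p) 2), ρ.toGaloisRep.IsIrreducible → (∀ᶠ v : HeightOneSpectrum (𝓞 F) in Filter.cofinite, ρ.IsUnramifiedAt v) → (∀ (v : HeightOneSpectrum (𝓞 F)) (hv : ((p : ℕ) : 𝓞 F) ∈ v.asIdeal), (fontainePstAdicCompletion v p hv).IsDeRhamFramed (ρ.toLocal v) ∧ (letI := (fontainePstAdicCompletion v p hv).algebra; ∀ τ : v.adicCompletion F →ₐ[ℚ_[p]] PadicAlgCl p, ∃ a b : ℤ, a < b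 ∧ ρ.labelledHodgeTateWeightsAt v (fontainePstAdicCompletion v p hv).algebra (fontainePstAdicCompletion v p hv).𝔅 τ.toRingHom = {a, b})) → (11 ≤ p ∧ (∃ v w : HeightOneSpectrum (𝓞 F), v ≠ w ∧ ((p : ℕ) : 𝓞 F) ∈ v.asIdeal ∧ ((p : ℕ) : 𝓞 F) ∈ w.asIdeal) ∧ (∀ (v : HeightOneSpectrum (𝓞 F)) (hv : ((p : ℕ) : 𝓞 F) ∈ v.asIdeal), (fontainePstAdicCompletion v p hv).IsCrystallineFramed (ρ.toLocal v)) ∧ FramedGaloisRep.IsResiduallyAbsIrreducible (ρ.restrictField (CyclotomicField p F))) → (∃ (v : HeightOneSpectrum (𝓞 F)) (hv : ((p : ℕ) : 𝓞 F) ∈ v.asIdeal) (w : HeightOneSpectrum (𝓞 F)) (hw : ((p : ℕ) : 𝓞 F) ∈ w.asIdeal), letI := (fontainePstAdicCompletion v p hv).algebra; letI := (fontainePstAdicCompletion w p hw).algebra; ∃ (τ : v.adicCompletion F →ₐ[ℚ_[p]] PadicAlgCl p) (σ : w.adicCompletion F →ₐ[ℚ_[p]] PadicAlgCl p) (a b a'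 b' : ℤ), ρ.labelledHodgeTateWeightsAt v (fontainePstAdicCompletion v p hv).algebra (fontainePstAdicCompletion v p hv).𝔅 τ.toRingHom = {a, b} ∧ a < b ∧ ρ.labelledHodgeTateWeightsAt w (fontainePstAdicCompletion w p hw).algebra (fontainePstAdicCompletion w p hw).𝔅 σ.toRingHom = {a', b'} ∧ a' < b' ∧ b - a ≠ b' - a') → (∀ (v : HeightOneSpectrum (𝓞 ℚ)) (hv : ((p : ℕ) : 𝓞 ℚ) ∈ v.asIdeal) (r : FramedGaloisRep (v.adicCompletion ℚ) (PadicAlgCl p) 2), (fontainePstAdicCompletion v p hv).IsCrystallineFramed r → (letI := (fontainePstAdicCompletion v p hv).algebra; (∀ τ : v.adicCompletion ℚ →ₐ[ℚ_[p]] PadicAlgCl p, ((fontainePstAdicCompletion v p hv).𝔅.labelledHodgeTateWeights r.toGaloisRep τ.toRingHom).Nodup) → ∀ 𝔈 : PstCrystallineExtensionData (fontainePstAdicCompletion v p hv), IsPotentiallyDiagonalizable 𝔈.𝔅 r)) → ∃ ψ : FramedGaloisRep ℚ (PadicAlgCl p) 4, (∀ τ : absoluteGaloisGroup ℚ, τ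 ∉ Set.range (absGaloisRestrict ℚ F) → ∀ σ σ' : absoluteGaloisGroup F, absGaloisRestrict ℚ F σ' = τ * absGaloisRestrict ℚ F σ * τ⁻¹ → (ψ (absGaloisRestrict ℚ F σ)).val.trace = (ρ σ).val.trace * (ρ σ').val.trace) ∧ (∀ᶠ v : HeightOneSpectrum (𝓞 ℚ) in Filter.cofinite, ψ.IsUnramifiedAt v) ∧ (∃ (J : Matrix (Fin 4) (Fin 4) (PadicAlgCl p)) (μ : absoluteGaloisGroup ℚ →* (PadicAlgCl p)ˣ), J.IsSymm ∧ IsUnit J.det ∧ (∀ g : absoluteGaloisGroup ℚ, (ψ g).val.transpose * J * (ψ g).val = (μ g : PadicAlgCl p) • J) ∧ ∀ (φ : ℚ →+* ℝ) (c : absoluteGaloisGroup ℚ), IsComplexConjugation φ c → μ c = 1) ∧ (∀ (v : HeightOneSpectrum (𝓞 ℚ)) (hv : ((p : ℕ) : 𝓞 ℚ) ∈ v.asIdeal), (fontainePstAdicCompletion v p hv).IsCrystallineFramed (ψ.toLocal v) ∧ (letI := (fontainePstAdicCompletion v p hv).algebra; (∀ τ : v.adicCompletion ℚ →ₐ[ℚ_[p]]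 PadicAlgCl p, (let M := ψ.labelledHodgeTateWeightsAt v (fontainePstAdicCompletion v p hv).algebra (fontainePstAdicCompletion v p hv).𝔅 τ.toRingHom; M.Nodup ∧ Multiset.card M = 4)) ∧ ∀ 𝔈 : PstCrystallineExtensionData (fontainePstAdicCompletion v p hv), IsPotentiallyDiagonalizable 𝔈.𝔅 (ψ.toLocal v))) ∧ (∀ (φ : ℚ →+* ℝ) (c : absoluteGaloisGroup ℚ), IsComplexConjugation φ c → (ψ c).val.trace ≠ 0) := by
  sorry

/-- **stub 3 — residual irreducibility criterion for the tensor induction (Clifford theory; the crux's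
recorded risk, isolated).**  If `ρ̄|Γ_{F(ζ_p)}` is absolutely irreducible, `ρ̄` is NOT of base-change type
over `Γ_F` (`¬` the crux's trace/determinant clause: no `τ ∈ Γ_ℚ ∖ Γ_F`, `χ̄` with `ρ̄^τ ≅ ρ̄ ⊗ χ̄`) and
`ρ̄|Γ_{F(ζ_p)}` is NOT projectively dihedral (no character `η ≠ 1` of `Γ_{F(ζ_p)}` with
`tr ρ̄ = η · tr ρ̄` on `Γ_{F(ζ_p)}`, i.e. `ρ̄|Γ_{F(ζ_p)}` is not induced from a quadratic extension), then every
`ψ : Γ_ℚ → GL₄(ℚ̄_p)` whose restriction to `Γ_F` has the character of `ρ ⊗ ρ^τ` (T0) is residually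
absolutely irreducible on `Γ_{ℚ(ζ_p)}`.  Proof sketch: `ψ̄|Γ_K ≅ (ρ̄ ⊗ ρ̄^c)|Γ_K` (`K = F(ζ_p)`, Brauer–Nesbitt);
for absolutely irreducible two-dimensional `r = ρ̄|Γ_K`, `r ⊗ r^c` is reducible only if `r^c ≅ r ⊗ χ` for a
character `χ` of `Γ_K` or `r`, `r^c` are induced from a common index-two subgroup (Ramakrishnan's cuspidality
criterion for `GL₂ × GL₂`, Galois side); in the first case either `χ` is `Gal(K/F)`-invariant — then it
extends through the cyclic prime-to-`p` quotient and `ρ̄^c ≅ ρ̄ ⊗ χ₀` over `Γ_F` (base-change type, excluded) —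
or `r ≅ r ⊗ (χ^g/χ)` is dihedral (excluded); the second case is dihedral too.  So `ψ̄` is irreducible on the
subgroup `Γ_K ≤ Γ_{ℚ(ζ_p)}`, hence on `Γ_{ℚ(ζ_p)}`.  Why it might fail: only through the characteristic-`p` Clifford /
Goursat–Dickson analysis of `r ⊗ r^c` (non-semisimple extensions; `p ≥ 11` excludes the exceptional images) and the
residual bookkeeping (`residualRep` of a restriction vs restriction of `residualRep`, both semisimple here).  Size M.
[cite: Calegari2010, §6] [cite: BarnetlambEtAl2014, Thm. C (irreducibility hypothesis)] -/
theorem stub_residualIrreducibility :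
    ∀ (F : Type) [Field F] [NumberField F] [Algebra.IsQuadraticExtension ℚ F], NumberField.IsTotallyComplex F → ∀ (p : ℕ) [Fact p.Prime] (ρ : FramedGaloisRep F (PadicAlgCl p) 2), ρ.toGaloisRep.IsIrreducible → (∀ᶠ v : HeightOneSpectrum (𝓞 F) in Filter.cofinite, ρ.IsUnramifiedAt v) → (∀ (v : HeightOneSpectrum (𝓞 F)) (hv : ((p : ℕ) : 𝓞 F) ∈ v.asIdeal), (fontainePstAdicCompletion v p hv).IsDeRhamFramed (ρ.toLocal v) ∧ (letI := (fontainePstAdicCompletion v p hv).algebra; ∀ τ : v.adicCompletion F →ₐ[ℚ_[p]] PadicAlgCl p, ∃ a b : ℤ, a < b ∧ ρ.labelledHodgeTateWeightsAt v (fontainePstAdicCompletion v p hv).algebra (fontainePstAdicCompletion v p hv).𝔅 τ.toRingHom = {a, b})) → (11 ≤ p ∧ (∃ v w : HeightOneSpectrum (𝓞 F), v ≠ w ∧ ((p : ℕ) : 𝓞 F) ∈ v.asIdeal ∧ ((p : ℕ) : 𝓞 F) ∈ w.asIdeal) ∧ (∀ (v : HeightOneSpectrum (𝓞 F)) (hv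 : ((p : ℕ) : 𝓞 F) ∈ v.asIdeal), (fontainePstAdicCompletion v p hv).IsCrystallineFramed (ρ.toLocal v)) ∧ FramedGaloisRep.IsResiduallyAbsIrreducible (ρ.restrictField (CyclotomicField p F))) → ¬ (∃ τ : absoluteGaloisGroup ℚ, τ ∉ Set.range (absGaloisRestrict ℚ F) ∧ ∃ χ : absoluteGaloisGroup F →* (padicAlgClResidueField p)ˣ, ∀ σ σ' : absoluteGaloisGroup F, absGaloisRestrict ℚ F σ' = τ * absGaloisRestrict ℚ F σ * τ⁻¹ → (ρ.residualRep σ').val.trace = (χ σ : padicAlgClResidueField p) * (ρ.residualRep σ).val.trace ∧ (ρ.residualRep σ').val.det = (χ σ : padicAlgClResidueField p) ^ 2 * (ρ.residualRep σ).val.det) → ¬ (∃ η : absoluteGaloisGroup (CyclotomicField p F) →* (padicAlgClResidueField p)ˣ, η ≠ 1 ∧ ∀ σ : absoluteGaloisGroup (CyclotomicField p F), (ρ.residualRep (absGaloisRestrict F (CyclotomicField p F) σ)).val.trace = (η σ : padicAlgClResidueField p) * (ρ.residualRep (absGaloisRestrict F (CyclotomicField p F) σ)).val.trace) → ∀ ψ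 : FramedGaloisRep ℚ (PadicAlgCl p) 4, (∀ τ : absoluteGaloisGroup ℚ, τ ∉ Set.range (absGaloisRestrict ℚ F) → ∀ σ σ' : absoluteGaloisGroup F, absGaloisRestrict ℚ F σ' = τ * absGaloisRestrict ℚ F σ * τ⁻¹ → (ψ (absGaloisRestrict ℚ F σ)).val.trace = (ρ σ).val.trace * (ρ σ').val.trace) → FramedGaloisRep.IsResiduallyAbsIrreducible (ψ.restrictField (CyclotomicField p ℚ)) := by
  sorry

/-- **stub 4 — the engine: potential automorphy (BLGGT Thm. C) + the sign of complex conjugation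
(Caraiani–Le Hung Thm. 1.1), `n = 4` over `ℚ`.**  For `p ≥ 11 > 2(4+1)` and `ψ : Γ_ℚ → GL₄(ℚ̄_p)` which is
(T1) unramified almost everywhere, (T2) valued in `GO₄` with totally even multiplier, (T3) crystalline with
four distinct labelled Hodge–Tate numbers and potentially diagonalisable at `p`, (T4) residually absolutely
irreducible on `Γ_{ℚ(ζ_p)}`: `tr ψ(c) = 0` for every complex conjugation `c`.  Proof: [BLGGT] Thm. C
(arXiv:1010.2561 p. 4: "either `r` maps to `GSp_n` with totally odd multiplier or it maps to `GO(n)` with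
totally even multiplier"; `l ≥ 2(n+1)`) gives a finite Galois totally real `F'/ℚ` with `ψ|Γ_{F'}` automorphic,
`≅ r_{p,ι}(Π)` for a regular algebraic (essentially self-dual) cuspidal `Π` of `GL₄(𝔸_{F'})`; every complex
conjugation of `Γ_ℚ` lies in `Γ_{F'}`; Caraiani–Le Hung 2016 Thm. 1.1 (tree fact
`Literature.NumberTheory.Automorphic.CaraianiLeHung2016_thm_1_1`, `n` even ⇒ trace `0`; Taylor 2012 in the
essentially self-dual case).  A Galois-side statement ("regular polarised even-orthogonal `ψ` are CLH-odd");
published theorems, size XL as a formalisation / citation-grade as a fact.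
[cite: BarnetlambEtAl2014, Thm. C] [cite: CaraianiLehung2016, Thm 1.1] -/
theorem stub_traceComplexConjugation :
    ∀ (p : ℕ) [Fact p.Prime], 11 ≤ p → ∀ ψ : FramedGaloisRep ℚ (PadicAlgCl p) 4, (∀ᶠ v : HeightOneSpectrum (𝓞 ℚ) in Filter.cofinite, ψ.IsUnramifiedAt v) → (∃ (J : Matrix (Fin 4) (Fin 4) (PadicAlgCl p)) (μ : absoluteGaloisGroup ℚ →* (PadicAlgCl p)ˣ), J.IsSymm ∧ IsUnit J.det ∧ (∀ g : absoluteGaloisGroup ℚ, (ψ g).val.transpose * J * (ψ g).val = (μ g : PadicAlgCl p) • J) ∧ ∀ (φ : ℚ →+* ℝ) (c : absoluteGaloisGroup ℚ), IsComplexConjugation φ c → μ c = 1) → (∀ (v : HeightOneSpectrum (𝓞 ℚ)) (hv : ((p : ℕ) : 𝓞 ℚ) ∈ v.asIdeal), (fontainePstAdicCompletion v p hv).IsCrystallineFramed (ψ.toLocal v) ∧ (letI := (fontainePstAdicCompletion v p hv).algebra; (∀ τ : v.adicCompletion ℚ →ₐ[ℚ_[p]] PadicAlgCl p, (let M := ψ.labelledHodgeTateWeightsAt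 v (fontainePstAdicCompletion v p hv).algebra (fontainePstAdicCompletion v p hv).𝔅 τ.toRingHom; M.Nodup ∧ Multiset.card M = 4)) ∧ ∀ 𝔈 : PstCrystallineExtensionData (fontainePstAdicCompletion v p hv), IsPotentiallyDiagonalizable 𝔈.𝔅 (ψ.toLocal v))) → FramedGaloisRep.IsResiduallyAbsIrreducible (ψ.restrictField (CyclotomicField p ℚ)) → ∀ (φ : ℚ →+* ℝ) (c : absoluteGaloisGroup ℚ), IsComplexConjugation φ c → (ψ c).val.trace = 0 := by
  sorry

/-- **stub 5 — the projectively dihedral corner (honest open remainder of this crux).**  The crux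
restricted to the locus where `ρ̄|Γ_{F(ζ_p)}` IS projectively dihedral (`tr ρ̄ = η · tr ρ̄` on `Γ_{F(ζ_p)}` for a
character `η ≠ 1`): there the tensor induction is residually reducible on `Γ_{ℚ(ζ_p)}` and [BLGGT] Thm. C does
not apply (the route's own "why it might fail": "that corner needs CM/dihedral methods instead"), so the
parallel-weight conclusion must come from elsewhere — CM/dihedral automorphy lifting for residually induced
`ρ̄` (Skinner–Wiles / Thorne-type adequacy-free theorems) or the ordinary-family argument of Calegari–Mazur
§2.4.  Strictly weaker than the route's `Target` (an instance of the Calegari–Mazur parallel-weight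
prediction, Conj. 1.3) and incomparable with the crux (extra hypothesis: dihedral residue); kept in the
crux's own conclusion shape so that any proof of the corner — or of `Target` — discharges it by name.  Size:
open (L if a dihedral automorphy-lifting theorem over imaginary quadratic fields in non-parallel weight is
vendored).  [cite: CalegariMazur2008, Conj. 1.3 and §2.4] [cite: Calegari2010, Thm 1.4] -/
theorem stub_dihedralCorner :
    ∀ (F : Type) [Field F] [NumberField F] [Algebra.IsQuadraticExtension ℚ F], NumberField.IsTotallyComplex F → ∀ (p : ℕ) [Fact p.Prime] (ρ : FramedGaloisRep F (PadicAlgCl p) 2), ρ.toGaloisRep.IsIrreducible → (∀ᶠ v : HeightOneSpectrum (𝓞 F) in Filter.cofinite, ρ.IsUnramifiedAt v) → (∀ (v : HeightOneSpectrum (𝓞 F)) (hv : ((p : ℕ) : 𝓞 F) ∈ v.asIdeal), (fontainePstAdicCompletion v p hv).IsDeRhamFramed (ρ.toLocal v) ∧ (letI := (fontainePstAdicCompletion v p hv).algebra; ∀ τ : v.adicCompletion F →ₐ[ℚ_[p]] PadicAlgCl p, ∃ a b : ℤ, a < b ∧ ρ.labelledHodgeTateWeightsAt v (fontainePstAdicCompletion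 v p hv).algebra (fontainePstAdicCompletion v p hv).𝔅 τ.toRingHom = {a, b})) → (11 ≤ p ∧ (∃ v w : HeightOneSpectrum (𝓞 F), v ≠ w ∧ ((p : ℕ) : 𝓞 F) ∈ v.asIdeal ∧ ((p : ℕ) : 𝓞 F) ∈ w.asIdeal) ∧ (∀ (v : HeightOneSpectrum (𝓞 F)) (hv : ((p : ℕ) : 𝓞 F) ∈ v.asIdeal), (fontainePstAdicCompletion v p hv).IsCrystallineFramed (ρ.toLocal v)) ∧ FramedGaloisRep.IsResiduallyAbsIrreducible (ρ.restrictField (CyclotomicField p F))) → ¬ (∀ (v : HeightOneSpectrum (𝓞 F)) (hv : ((p : ℕ) : 𝓞 F) ∈ v.asIdeal) (w : HeightOneSpectrum (𝓞 F)) (hw : ((p : ℕ) : 𝓞 F) ∈ w.asIdeal), letI := (fontainePstAdicCompletion v p hv).algebra; letI := (fontainePstAdicCompletion w p hw).algebra; ∀ (τ : v.adicCompletion F →ₐ[ℚ_[p]] PadicAlgCl p) (σ : w.adicCompletion F →ₐ[ℚ_[p]] PadicAlgCl p) (a b a' b' : ℤ), ρ.labelledHodgeTateWeightsAt v (fontainePstAdicCompletion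 v p hv).algebra (fontainePstAdicCompletion v p hv).𝔅 τ.toRingHom = {a, b} → a < b → ρ.labelledHodgeTateWeightsAt w (fontainePstAdicCompletion w p hw).algebra (fontainePstAdicCompletion w p hw).𝔅 σ.toRingHom = {a', b'} → a' < b' → Even (b - a + (b' - a'))) → ¬ (∃ τ : absoluteGaloisGroup ℚ, τ ∉ Set.range (absGaloisRestrict ℚ F) ∧ ∃ χ : absoluteGaloisGroup F →* (padicAlgClResidueField p)ˣ, ∀ σ σ' : absoluteGaloisGroup F, absGaloisRestrict ℚ F σ' = τ * absGaloisRestrict ℚ F σ * τ⁻¹ → (ρ.residualRep σ').val.trace = (χ σ : padicAlgClResidueField p) * (ρ.residualRep σ).val.trace ∧ (ρ.residualRep σ').val.det = (χ σ : padicAlgClResidueField p) ^ 2 * (ρ.residualRep σ).val.det) → (∃ η : absoluteGaloisGroup (CyclotomicField p F) →* (padicAlgClResidueField p)ˣ, η ≠ 1 ∧ ∀ σ : absoluteGaloisGroup (CyclotomicField p F), (ρ.residualRep (absGaloisRestrict F (CyclotomicField p F) σ)).val.trace = (η σ : padicAlgClResidueField p) * (ρ.residualRep (absGaloisRestrict F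 (CyclotomicField p F) σ)).val.trace) → ∃ g : ℤ, ∀ (v : HeightOneSpectrum (𝓞 F)) (hv : ((p : ℕ) : 𝓞 F) ∈ v.asIdeal), letI := (fontainePstAdicCompletion v p hv).algebra; ∀ τ : v.adicCompletion F →ₐ[ℚ_[p]] PadicAlgCl p, ∃ a : ℤ, ρ.labelledHodgeTateWeightsAt v (fontainePstAdicCompletion v p hv).algebra (fontainePstAdicCompletion v p hv).𝔅 τ.toRingHom = {a, a + g} := by
  sorry

/-! ## The stub statements as named `Prop`s (literally their types) — the registrar's by-name hypotheses -/

namespace _Goal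

/-- The statement of `stub_localPD`, as a named `Prop` (literally its type; no `sorry` in it). -/
def stub_localPD : Prop :=
  type_of% @Summit.Langlands.Langlands.Cruxes.TensorSquareParallel.Birth.stub_localPD

/-- The statement of `stub_tensorInduction`, as a named `Prop` (literally its type; no `sorry` in it). -/
def stub_tensorInduction : Prop :=
  type_of% @Summit.Langlands.Langlands.Cruxes.TensorSquareParallel.Birth.stub_tensorInduction

/-- The statement of `stub_residualIrreducibility`, as a named `Prop` (literally its type; no `sorry` in it). -/
def stub_residualIrreducibility : Prop :=
  type_of% @Summit.Langlands.Langlands.Cruxes.TensorSquareParallel.Birth.stub_residualIrreducibility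

/-- The statement of `stub_traceComplexConjugation`, as a named `Prop` (literally its type; no `sorry` in it). -/
def stub_traceComplexConjugation : Prop :=
  type_of% @Summit.Langlands.Langlands.Cruxes.TensorSquareParallel.Birth.stub_traceComplexConjugation

/-- The statement of `stub_dihedralCorner`, as a named `Prop` (literally its type; no `sorry` in it). -/
def stub_dihedralCorner : Prop :=
  type_of% @Summit.Langlands.Langlands.Cruxes.TensorSquareParallel.Birth.stub_dihedralCorner

end _Goal

/-- Read-back: the five stubs prove their named statements (definitionally their own types). -/
theorem goals_hold :
    _Goal.stub_localPD ∧ _Goal.stub_tensorInduction ∧ _Goal.stub_residualIrreducibility ∧ _Goal.stub_traceComplexConjugation ∧ _Goal.stub_dihedralCorner :=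
  ⟨stub_localPD, stub_tensorInduction, stub_residualIrreducibility, stub_traceComplexConjugation, stub_dihedralCorner⟩

/-- **`TensorSquareParallel` from its five stubs** — kernel-checked composition (no sorry).  Case split on
the projectively dihedral predicate over `F(ζ_p)`: on the corner, stub 5 verbatim; off it, the negated parity
clause of the crux yields two labels with different gaps (if all gaps at all pairs of labels were equal every
gap sum `(b − a) + (b' − a')` would be even), stub 1 supplies the local potential-diagonalisability input at
`p`, stub 2 the tensor induction `ψ`, stub 3 its residual irreducibility on `Γ_{ℚ(ζ_p)}`, and stub 4
`tr ψ(c) = 0` at a complex conjugation `c ∈ Γ_ℚ` (which exists: `exists_isComplexConjugation (Rat.castHom ℝ)`),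
contradicting `tr ψ(c) ≠ 0` — the odd-gap-difference, non-base-change sector is void.
[cite: Calegari2010, §2] [cite: BarnetlambEtAl2014, Thm. C] [cite: CaraianiLehung2016, Thm 1.1] -/
theorem TensorSquareParallel_of
    (h₁ : _Goal.stub_localPD) (h₂ : _Goal.stub_tensorInduction) (h₃ : _Goal.stub_residualIrreducibility)
    (h₄ : _Goal.stub_traceComplexConjugation) (h₅ : _Goal.stub_dihedralCorner) :
    Summit.Langlands.Langlands.Theses.NonParallelVoid.TensorSquareParallel := by
  -- the stub statements, as the Π-types they literally are
  have HPD : type_of% @stub_localPD := h₁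
  have HTI : type_of% @stub_tensorInduction := h₂
  have HRI : type_of% @stub_residualIrreducibility := h₃
  have HTZ : type_of% @stub_traceComplexConjugation := h₄
  have HDC : type_of% @stub_dihedralCorner := h₅
  clear h₁ h₂ h₃ h₄ h₅
  intro F _ _ _ hF p _ ρ hirr hunr hHT hG hE hB
  by_cases hD : (∃ η : absoluteGaloisGroup (CyclotomicField p F) →* (padicAlgClResidueField p)ˣ, η ≠ 1 ∧ ∀ σ : absoluteGaloisGroup (CyclotomicField p F), (ρ.residualRep (absGaloisRestrict F (CyclotomicField p F) σ)).val.trace = (η σ : padicAlgClResidueField p) * (ρ.residualRep (absGaloisRestrict F (CyclotomicField p F) σ)).val.trace)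
  · -- the projectively dihedral corner: stub 5
    exact HDC F hF p ρ hirr hunr hHT hG hE hB hD
  · -- off the corner the sector is void
    exfalso
    -- two labels with different gaps, from the failure of the parity clause
    have hNP : (∃ (v : HeightOneSpectrum (𝓞 F)) (hv : ((p : ℕ) : 𝓞 F) ∈ v.asIdeal) (w : HeightOneSpectrum (𝓞 F)) (hw : ((p : ℕ) : 𝓞 F) ∈ w.asIdeal), letI := (fontainePstAdicCompletion v p hv).algebra; letI := (fontainePstAdicCompletion w p hw).algebra; ∃ (τ : v.adicCompletion F →ₐ[ℚ_[p]] PadicAlgCl p) (σ : w.adicCompletion F →ₐ[ℚ_[p]] PadicAlgCl p) (a b a' b' : ℤ), ρ.labelledHodgeTateWeightsAt v (fontainePstAdicCompletion v p hv).algebra (fontainePstAdicCompletion v p hv).𝔅 τ.toRingHom = {a, b} ∧ a < b ∧ ρ.labelledHodgeTateWeightsAt w (fontainePstAdicCompletion w p hw).algebra (fontainePstAdicCompletion w p hw).𝔅 σ.toRingHom = {a', b'} ∧ a' < b' ∧ b - a ≠ b' - a') := by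
      by_contra hcon
      apply hE
      intro v hv w hw τ σ a b a' b' h1 h2 h3 h4
      by_contra hodd
      exact hcon ⟨v, hv, w, hw, τ, σ, a, b, a', b', h1, h2, h3, h4, fun heq => hodd ⟨b - a, by rw [← heq]⟩⟩
    -- stub 1: two-dimensional crystalline regular representations of Γ_(ℚ_p) are potentially diagonalisable
    have hPD := HPD p hG.1
    -- stub 2: the tensor induction
    obtain ⟨ψ, hT0, hT1, hT2, hT3, hT5⟩ := HTI F hF p ρ hirr hunr hHT hG hNP hPD
    -- stub 3: residually absolutely irreducible on Γ_(ℚ(ζ_p))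
    have hT4 := HRI F hF p ρ hirr hunr hHT hG hB hD ψ hT0
    -- a complex conjugation of Γ_ℚ, and stub 4
    obtain ⟨c, hc⟩ := exists_isComplexConjugation (Rat.castHom ℝ)
    exact hT5 _ c hc (HTZ p hG.1 ψ hT1 hT2 hT3 hT4 _ c hc)

/-- By-name sanity check (an `example`, not a declaration): the five stubs feed the composition as they
stand — `TensorSquareParallel` modulo exactly the five stubs (the only sorries of the file). -/
example : Summit.Langlands.Langlands.Theses.NonParallelVoid.TensorSquareParallel :=
  TensorSquareParallel_of stub_localPD stub_tensorInduction stub_residualIrreducibility stub_traceComplexConjugation stub_dihedralCorner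

end Summit.Langlands.Langlands.Cruxes.TensorSquareParallel.Birth

end
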